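import Summits.Ventures.PercRepro2.CaseOnePairPocketMain
import Summits.Ventures.PercRepro2.CaseOneRootsAndBIQClass

/-!
# A statement vertex and the mark `b` in a common pocket at a root are closed (blind cell PercRepro2,
p1 g28; the twin with `b` of `closedAt_of_pair_at_root`, P1-G27 §3 (2))

With `(i-Q)` of the roots-and-`b` class in the tree (`zSplitIQ_of_a1b`, `zSplitIQ_of_a2b`), the
vertex `a₃ ~ {a₁, b}` (resp. `{a₂, b}`) through single edges is CLOSED (**`closedAt_of_a1b`**,
**`closedAt_of_a2b`**: all four forms, every weight vector). In the tree gadget of the pair reduction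
with `z₁ = a₃`, `z₂ = b` the hub `w` has, after the leaf edge `e₂` is deleted, exactly the edges `e₁`
to the cut vertex `x` (a root) and `e₃` to `b` (**`IsPairPocket.hub_edges_b`**), so the pendant move
and `closedAt_of_pair` give **`closedAt_of_pair_at_root_b`**: a statement vertex and `b` in a common
mark-free-otherwise pocket hanging at a root are closed (`a₁, a₂, o` outside), and
**`jOneOne_of_pair_at_root_b`**. Own code; standard axioms.
-/

universe u

namespace Summit.Ventures.PercRepro2

namespace CaseOne

section A1B
variable {V : Type*} {E : Type*} [Fintype E] [DecidableEq E] [Fintype V] [DecidableEq V]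
  {R : Type*} [Field R] [LinearOrder R] [IsStrictOrderedRing R]
variable {ends : E → Sym2 V} {o a₁ a₂ a₃ b : V} {e₁ eb : E}

omit [Fintype E] [DecidableEq E] [Fintype V] [DecidableEq V] in
/-- The root-edge description of `a₃ ~ {a₁, b}`. -/
lemma a1b_hroot (he₁ : ends e₁ = s(a₁, a₃)) (hunique : ∀ e, a₃ ∈ ends e → e = e₁ ∨ e = eb) :
    ∀ e, a₃ ∈ ends e → e ≠ eb → ends e = s(a₁, a₃) ∨ ends e = s(a₂, a₃) := by
  intro e he hne
  rcases hunique e he with h | h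
  · exact Or.inl (by rw [h, he₁])
  · exact absurd h hne

omit [Fintype E] [DecidableEq E] [Fintype V] [DecidableEq V] in
/-- The root-edge description of `a₃ ~ {a₂, b}`. -/
lemma a2b_hroot (he₂ : ends e₁ = s(a₂, a₃)) (hunique : ∀ e, a₃ ∈ ends e → e = e₁ ∨ e = eb) :
    ∀ e, a₃ ∈ ends e → e ≠ eb → ends e = s(a₁, a₃) ∨ ends e = s(a₂, a₃) := by
  intro e he hne
  rcases hunique e he with h | h
  · exact Or.inr (by rw [h, he₂])
  · exact absurd h hne

/-- **`a₃ ~ {a₁, b}` through single edges is closed.** -/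
theorem closedAt_of_a1b (he₁ : ends e₁ = s(a₁, a₃)) (heb : ends eb = s(b, a₃)) (h1b : e₁ ≠ eb)
    (hunique : ∀ e, a₃ ∈ ends e → e = e₁ ∨ e = eb) (h1 : a₁ ≠ a₃) (h2 : a₂ ≠ a₃) (ho : o ≠ a₃)
    (hb : b ≠ a₃) : ClosedAt R o a₁ a₂ b E ends a₃ := fun p hp =>
  ⟨zSplitII_of_rootsAndB p hp heb (a1b_hroot he₁ hunique) hb h1 h2 ho,
    zSplitIIQ_of_rootsAndB p hp heb (a1b_hroot he₁ hunique) hb h1 o,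
    zSplitI_of_rootsAndB p hp heb (a1b_hroot he₁ hunique) hb h1 h2 ho,
    zSplitIQ_of_a1b p hp he₁ heb h1b hunique h1 h2 ho hb⟩

/-- **`a₃ ~ {a₂, b}` through single edges is closed.** -/
theorem closedAt_of_a2b (he₂ : ends e₁ = s(a₂, a₃)) (heb : ends eb = s(b, a₃)) (h2b : e₁ ≠ eb)
    (hunique : ∀ e, a₃ ∈ ends e → e = e₁ ∨ e = eb) (h1 : a₁ ≠ a₃) (h2 : a₂ ≠ a₃) (ho : o ≠ a₃)
    (hb : b ≠ a₃) : ClosedAt R o a₁ a₂ b E ends a₃ := fun p hp =>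
  ⟨zSplitII_of_rootsAndB p hp heb (a2b_hroot he₂ hunique) hb h1 h2 ho,
    zSplitIIQ_of_rootsAndB p hp heb (a2b_hroot he₂ hunique) hb h1 o,
    zSplitI_of_rootsAndB p hp heb (a2b_hroot he₂ hunique) hb h1 h2 ho,
    zSplitIQ_of_a2b p hp he₂ heb h2b hunique h1 h2 ho hb⟩

end A1B

section PairB
variable {V : Type*} {E : Type u} [DecidableEq E]
variable {ends : E → Sym2 V} {W : Set V} {x : V} {P : Finset E} {e₁ e₂ e₃ : E} {w : V}
  {a₃ b : V}

/-- **The hub of the gadget minus the leaf edge, with `z₂ = b`**: its edges are exactly `e₁` (to `x`)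
and `e₃` (to `b`). -/
lemma IsPairPocket.hub_edges_b (hh : IsPairPocket ends W x P e₁ e₂ e₃ w a₃ b) :
    restrictEnds (pairEnds ends P e₁ e₂ e₃ x w a₃ b) e₂ ⟨e₁, hh.ne₁₂⟩ = s(x, w) ∧
      restrictEnds (pairEnds ends P e₁ e₂ e₃ x w a₃ b) e₂ ⟨e₃, hh.ne₂₃.symm⟩ = s(b, w) ∧
      ∀ e : {e : E // e ≠ e₂}, w ∈ restrictEnds (pairEnds ends P e₁ e₂ e₃ x w a₃ b) e₂ e →
        e = ⟨e₁, hh.ne₁₂⟩ ∨ e = ⟨e₃, hh.ne₂₃.symm⟩ := by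
  refine ⟨?_, ?_, ?_⟩
  · simp only [restrictEnds]
    rw [pairEnds_e₁]
  · simp only [restrictEnds]
    rw [pairEnds_e₃ hh.ne₁₃ hh.ne₂₃, Sym2.eq_swap]
  · intro e hmem
    simp only [restrictEnds] at hmem
    by_cases he1 : e.1 = e₁
    · exact Or.inl (Subtype.ext he1)
    by_cases he3 : e.1 = e₃
    · exact Or.inr (Subtype.ext he3)
    by_cases heP : e.1 ∈ P
    · rw [pairEnds_of_mem heP he1 e.2 he3, Sym2.mem_iff] at hmem
      rcases hmem with h | h <;> exact absurd (h ▸ hh.hub) hh.pocket.x_not_mem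
    · rw [pairEnds_of_not_mem heP hh.mem₁ hh.mem₂ hh.mem₃] at hmem
      exact absurd (hh.pocket.mem_P hh.hub hmem) heP

end PairB

section PairRootB
variable {V : Type*} [Fintype V] [DecidableEq V] {R : Type*} [Field R] [LinearOrder R]
  [IsStrictOrderedRing R] {E : Type u} [Fintype E] [DecidableEq E]
variable {ends : E → Sym2 V} {W : Set V} {x : V} {P : Finset E} {e₁ e₂ e₃ : E} {w : V}
  {o a₁ a₂ a₃ b : V}

/-- **A statement vertex and the mark `b` in a common pocket hanging at a root are closed**: the
pocket (W, x, P) contains `a₃` and `b` (and the hub `w`), the cut vertex `x` is a root, and `a₁, a₂, o`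
are outside. -/
theorem closedAt_of_pair_at_root_b (hh : IsPairPocket ends W x P e₁ e₂ e₃ w a₃ b)
    (hx : x = a₁ ∨ x = a₂) (h1 : a₁ ∉ W) (h2 : a₂ ∉ W) (ho : o ∉ W) :
    ClosedAt R o a₁ a₂ b E ends a₃ := by
  refine closedAt_of_pair hh h1 h2 (Or.inl ho) (Or.inr (Or.inl rfl)) (Or.inr (Or.inr rfl)) ?_
  have hmove : Moves o a₁ a₂ b {e : E // e ≠ e₂}
      (restrictEnds (pairEnds ends P e₁ e₂ e₃ x w a₃ b) e₂) w E
      (pairEnds ends P e₁ e₂ e₃ x w a₃ b) a₃ :=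
    Moves.tail (Moves.refl _ _ _)
      (MoveStep.leafMove E (pairEnds ends P e₁ e₂ e₃ x w a₃ b) w a₃ e₂ hh.isLeafAt_hub
        (fun h => ho (h ▸ hh.mem_z₁)) (fun h => h1 (h ▸ hh.mem_z₁)) (fun h => h2 (h ▸ hh.mem_z₁))
        hh.ne_z.symm)
  obtain ⟨hE1, hE3, huniq⟩ := hh.hub_edges_b
  have h13 : (⟨e₁, hh.ne₁₂⟩ : {e : E // e ≠ e₂}) ≠ ⟨e₃, hh.ne₂₃.symm⟩ :=
    fun h => hh.ne₁₃ (Subtype.ext_iff.1 h)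
  have hw1 : a₁ ≠ w := fun h => h1 (h ▸ hh.hub)
  have hw2 : a₂ ≠ w := fun h => h2 (h ▸ hh.hub)
  have hwo : o ≠ w := fun h => ho (h ▸ hh.hub)
  have hwb : b ≠ w := hh.hub_ne₂.symm
  refine closedAt_of_moves hmove ?_
  rcases hx with rfl | rfl
  · exact closedAt_of_a1b hE1 hE3 h13 huniq hw1 hw2 hwo hwb
  · exact closedAt_of_a2b hE1 hE3 h13 huniq hw1 hw2 hwo hwb

/-- `(J1₁)` at a statement vertex sharing a pocket at a root with the mark `b`. -/
theorem jOneOne_of_pair_at_root_b (hh : IsPairPocket ends W x P e₁ e₂ e₃ w a₃ b)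
    (hx : x = a₁ ∨ x = a₂) (h1 : a₁ ∉ W) (h2 : a₂ ∉ W) (ho : o ∉ W) (p : E → R) (hp : IsProbVec p) :
    JOneOne p ends o a₁ a₂ a₃ b :=
  jOneOne_of_i_of_ii p ends o a₁ a₂ a₃ b (closedAt_of_pair_at_root_b hh hx h1 h2 ho p hp).2.2.1
    (closedAt_of_pair_at_root_b hh hx h1 h2 ho p hp).1

end PairRootB

end CaseOne

end Summit.Ventures.PercRepro2
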